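import Literature.Barriers.AtomisticToContinuum.TetrahedralFrustration
import HarnessLib

/-!
# The truncated dodecahedral bound (Hales; as used by Bezdek–Reid 2013, Theorem 7)

Topic `Literature/Geometry/DiscreteGeometry`; companion of
`Literature/Barriers/AtomisticToContinuum/TetrahedralFrustration.lean`, whose vocabulary it reuses
(`IsUnitBallPacking`, `voronoiCell V v = {p | ∀ w ∈ V, dist p v ≤ dist p w}`, the exact volume
`dodecahedronVolume = 10 (3 − √5) √(5 − 2√5) = V_D ≈ 5.5503` of the regular dodecahedron of unit
inradius, and the named fact `HalesMcLaughlin_dodecahedral` : `vol Ω(V, v) ≥ V_D`).  Vendored for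
the venture cell `pub-crystal3d` (packing-side inputs of the Bezdek–Reid contact-number chain):
there the Voronoi cells of a FINITE packing are unbounded at the boundary, so the chain needs the
bound for the cell TRUNCATED by the ball of radius `√2` about its centre.

## Source, as printed

K. Bezdek, S. Reid, *Contact graphs of unit sphere packings revisited*, J. Geom. 104 (2013)
57–83 = arXiv:1210.5756, Theorem 7 (quoting Hales, *Dense Sphere Packings*, "Lemma 9.13 on
p. 228" of the 2011 draft; likewise Bezdek, Discrete Comput. Geom. 48 (2012), Lemma 3.3): "Let `ℱ`
be an arbitrary (finite or infinite) family of non-overlapping unit balls in `𝔼³` with the unit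
ball `B` centered at the origin `o` of `𝔼³` belonging to `ℱ`. Let `P` stand for the Voronoi cell
of the packing `ℱ` assigned to `B`. Let `Q` denote a regular dodecahedron circumscribed `B` (having
circumradius `√3 tan(π/5) = 1.2584…`).  Finally, let `r := √2 = 1.4142…` and let `rB` denote the
ball of radius `r` centered at the origin `o` of `𝔼³`. Then
`vol₃(B)/vol₃(P) ≤ vol₃(B)/vol₃(P ∩ rB) ≤ vol₃(B)/vol₃(Q) < 0.7547`."
In the published blueprint (T. C. Hales, *Dense Sphere Packings*, CUP 2012, §8.6) the truncated
statement is inside the proof of Lemma 8.56 ("`surf(Ω) ≥ surf(Ω ∩ B) = ∑ surf(D_k(u)) ≥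
−12π a_D − 72π b_D`" `= A_D`, with `B` the ball of radius `√2` about `u₀`, Definition 8.49) together
with the pyramid argument of Lemma 8.48 (`vol = ∑ Aᵢ hᵢ/3 ≥ A_D/3 = vol_D`, all facet distances
`hᵢ ≥ 1`, the spherical part of `∂(Ω ∩ B)` being at distance `√2 ≥ 1`); it rests on the computer-
verified local inequality Lemma 8.55 and on the main estimate (6.95) `∑ L(h) ≤ 12`, and (Remark
8.45) saturating the packing only shrinks the cell.  Not re-proved here.

## Contents (namespace `Literature.Geometry.DiscreteGeometry`)

* `HalesDSP_truncatedDodecahedral` — NAMED FACT: for every packing of unit balls `V` and `v ∈ V`,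
  `vol (Ω(V, v) ∩ B̄(v, √2)) ≥ V_D` (the middle inequality of the display, with the exact
  dodecahedron volume in place of the decimal).
* PROVED: `HalesMcLaughlin_dodecahedral_of_truncated` (it implies the tree's untruncated fact,
  the cell being larger than its truncation); the printed decimal
  `unitBallVolume_div_dodecahedronVolume_lt : (4π/3)/V_D < 0.7547` (from `π < 3.141593` and
  `√5 < 2.23606798`; the true value is `0.754697…`, so the margin is `3·10⁻⁶`), and the packaged
  consequence `volume_truncatedVoronoiCell_gt_of` : `(4π/3)/0.7547 < vol (Ω ∩ B̄(v, √2))`.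
-/

noncomputable section

namespace Literature.Geometry.DiscreteGeometry

open MeasureTheory Metric Real
open Literature.Barriers.AtomisticToContinuum (voronoiCell dodecahedronVolume
  dodecahedronVolume_sq dodecahedronVolume_pos HalesMcLaughlin_dodecahedral)

/-- **The truncated dodecahedral bound (Hales, *Dense Sphere Packings*; Bezdek–Reid 2013,
Theorem 7).**  For an arbitrary (finite or infinite) packing of unit balls with centre set `V` and
any `v ∈ V`, the Voronoi cell of `v` truncated by the closed ball of radius `√2` about `v` has
volume at least that of the regular dodecahedron of unit inradius:
`vol (Ω(V, v) ∩ B̄(v, √2)) ≥ V_D = 10 (3 − √5) √(5 − 2√5)`, i.e. "`vol₃(B)/vol₃(P ∩ √2 B) ≤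
vol₃(B)/vol₃(Q)`".  Computer-assisted in print (DSP Lemma 8.55 + the estimate `∑ L(h) ≤ 12`).
[cite: BezdekReid2013, Theorem 7] -/
def HalesDSP_truncatedDodecahedral : Prop :=
  ∀ V : Set (EuclideanSpace ℝ (Fin 3)), IsUnitBallPacking V → ∀ v ∈ V,
    ENNReal.ofReal dodecahedronVolume ≤
      volume (voronoiCell V v ∩ closedBall v (Real.sqrt 2))

/-- The truncated bound implies the dodecahedral theorem in the tree's untruncated form
(`HalesMcLaughlin_dodecahedral`: `vol Ω(V, v) ≥ V_D`), the cell containing its truncation — the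
first inequality "`vol₃(B)/vol₃(P) ≤ vol₃(B)/vol₃(P ∩ rB)`" of the display.
[cite: BezdekReid2013, Theorem 7] -/
theorem HalesMcLaughlin_dodecahedral_of_truncated (h : HalesDSP_truncatedDodecahedral) :
    HalesMcLaughlin_dodecahedral := by
  intro V hV v hv
  exact le_trans (h V hV v hv) (measure_mono Set.inter_subset_left)

/-- `√5 < 2.23606798` (so `130 − 58√5 > 0.3080571`). [folklore] -/
private theorem sqrt_five_lt : √5 < 2.23606798 :=
  (Real.sqrt_lt' (by norm_num)).2 (by norm_num)

/-- A finer lower bound for the dodecahedron volume: `5.55028 < V_D` (true value `5.5502910…`).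
[folklore] -/
private theorem dodecahedronVolume_gt : (5.55028 : ℝ) < dodecahedronVolume := by
  have hsq := dodecahedronVolume_sq
  have hpos := dodecahedronVolume_pos
  have h5 := sqrt_five_lt
  nlinarith

/-- **The printed decimal**: `vol₃(B)/vol₃(Q) < 0.7547` for the unit ball `B` (volume `4π/3`) and
the regular dodecahedron `Q` of unit inradius (volume `V_D`); numerically `0.754697… < 0.7547`.
[cite: BezdekReid2013, Theorem 7] -/
theorem unitBallVolume_div_dodecahedronVolume_lt :
    (4 * π / 3) / dodecahedronVolume < 0.7547 := by
  have hV := dodecahedronVolume_gt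
  have hpos := dodecahedronVolume_pos
  have hpi := Real.pi_lt_d6
  rw [div_lt_iff₀ hpos]
  nlinarith

/-- Packaged consequence for the contact-number chain: under the truncated dodecahedral bound,
every truncated Voronoi cell of a unit-ball packing has volume `> (4π/3)/0.7547`, i.e.
"`vol₃(B)/vol₃(P ∩ √2 B) < 0.7547`". [cite: BezdekReid2013, Theorem 7] -/
theorem volume_truncatedVoronoiCell_gt_of (h : HalesDSP_truncatedDodecahedral)
    {V : Set (EuclideanSpace ℝ (Fin 3))} (hV : IsUnitBallPacking V) {v : EuclideanSpace ℝ (Fin 3)}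
    (hv : v ∈ V) :
    ENNReal.ofReal ((4 * π / 3) / 0.7547) <
      volume (voronoiCell V v ∩ closedBall v (Real.sqrt 2)) := by
  refine lt_of_lt_of_le ?_ (h V hV v hv)
  rw [ENNReal.ofReal_lt_ofReal_iff dodecahedronVolume_pos]
  have h1 := unitBallVolume_div_dodecahedronVolume_lt
  have hpos := dodecahedronVolume_pos
  rw [div_lt_iff₀ hpos] at h1
  rw [div_lt_iff₀ (by norm_num : (0 : ℝ) < 0.7547)]
  linarith

end Literature.Geometry.DiscreteGeometry

end
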